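import Summits.BirchSwinnertonDyer.BirchSwinnertonDyer.Theorems.SignedLowerHalvesKobayashiLowerHalfLargeImageKuriharaRigidityThreeKatoFrame
import Literature.NumberTheory.EllipticCurves.KimKimSun2020.KatoMainIdentityOfUnitKuriharaNumberThreeOPEN
import HarnessLib

/-!
# Line `kurihara_rigidity` at `p = 3`: the lead's composite binder `KimKimSun2020_thm11_via_kobayashi74_three` and its
# pair consumer FROM NAMED FACTS BY NAME — KKS Thm 1.1 at 3 on the `η = 1` package (claim-grade, flag `KKS20@3-MR-H4`),
# Kobayashi Thm 1.2, the period facts; Kobayashi 7.4 IN THE KERNEL (crux `KobayashiLowerHalfLargeImage` = item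
# stmt-BirchSwinnertonDyer-19001, stub `stub_three`; cell `bsd-ssimc`, seat `bsd-line-slh-p1-w2` g2; `--supports … --as helper`)

The sibling `…KuriharaRigidityThreeKatoFrame` (p614316) derives the lead gen 2's composite binder
`KimKimSun2020_thm11_via_kobayashi74_three` (p611880) from a DISPLAYED frame — the body of
`KimKimSun2020.thm11_katoMainIdentity_of_kuriharaNumber_ne_zero_three_OPEN`, then in flight (p614127). That statement
has LANDED; this file restates the derivation with the fact BY NAME (§1) and re-keys the lead's pair consumer on the
finer inputs (§2): at `p = 3` good, `a₃ = 0`, `ρ̄` onto + tower, (Tam), a newform with a unit Kurihara number at a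
cyclic level ⟹ `KobayashiMainConjecture W 3 ε` for every sign, CONDITIONAL on {KKS Thm 1.1 at 3 on the package
[claim-grade: flag `KKS20@3-MR-H4` — printed proof ⟸ MR (H.4b) `p > 4`; repair Sakamoto 2022/2024 (PUB, artinian) +
Kim 2025 Thm 3.18 (PRE, Λ-adic)], Kobayashi Thm 1.2, the `p = 3` period fact [PUBLISHED]} — Kobayashi 7.4 in the
kernel (lead's `…Thm74Odd`, p612293). TRUST BASE of the line's `p = 3`, `3 ∤ Tam` road after this file: 1 claim-grade
statement on Kato's objects + 2 published facts; 0 composite binders. HONEST FRAMING (cell `bsd-ssimc`,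
D-0036/D-0074): TOOL THEOREMS ONLY, no definition, no named fact minted, no `sorry`, axioms standard; `stub_three`,
the crux and the route are NOT closed; nothing is booked; BSD is not proved by any of this.
`--supports stmt-BirchSwinnertonDyer-19001 --as helper`.

References: [KimKimSun2020] Thm 1.1, (Tam) p. 4, Lemma 4.3, §7.4, §8.2.2; [Kobayashi2003] Thm 1.2, Thm 7.4 (p. 13);
[Sakamoto2024KolyvaginThree] Thm 1.1; [Kim2025RefinedTNC] §3.2.2, Thm 3.18; [GreenbergVatsal2000] §3 Rem 3.4;
[Mazur1978] Cor 4.1.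
-/

set_option autoImplicit false
-- single-problem summit (D-0017): the doubled namespace component is by design
set_option linter.dupNamespace false

noncomputable section

open scoped Classical MatrixGroups ModularForm

open CongruenceSubgroup Field WeierstrassCurve Literature.NumberTheory.EllipticCurves
  Literature.NumberTheory.EllipticCurves.ModularForms Literature.NumberTheory.GaloisRepresentations
  Literature.NumberTheory.EllipticCurves.Rank1Residual Summit.BirchSwinnertonDyer.Rank1Residual.Supersingular
  Summit.BirchSwinnertonDyer.Rank1Residual.X4

namespace Summit.BirchSwinnertonDyer.BirchSwinnertonDyer.Theorems.KuriharaRigidity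

/-! ## §1 The lead's `p = 3` binder from named facts BY NAME -/

/-- **`KimKimSun2020_thm11_via_kobayashi74_three` from NAMED inputs**: KKS Thm 1.1 at `3` read on the `η = 1` package
(`hKKS3 : KimKimSun2020.thm11_katoMainIdentity_of_kuriharaNumber_ne_zero_three_OPEN`, claim-grade, flag
`KKS20@3-MR-H4` — never a theorem), Kobayashi Thm 1.2 (`h12`), the period facts (`h5`, `h3`) — by
`kimKimSun2020_thm11_via_kobayashi74_three_of_katoFrame` (Kobayashi Thm 7.4 (ii) in the kernel at odd `p`).
CONDITIONAL; closes nothing. [claim: Kim2025RefinedTNC, status: under-review]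
[cite: KimKimSun2020, Thm. 1.1 (p. 4), §7.4] [cite: Kobayashi2003, Thm. 7.4 (p. 13), Thm. 1.2 (p. 2)] -/
theorem kimKimSun2020_thm11_via_kobayashi74_three_of_facts
    (hKKS3 : KimKimSun2020.thm11_katoMainIdentity_of_kuriharaNumber_ne_zero_three_OPEN)
    (h12 : Kobayashi2003.thm12_signedSelmerDual_finite_torsion)
    (h5 : realPeriodRat_eq_unit_mul_plusPeriod) (h3 : realPeriodRat_eq_unit_mul_plusPeriod_three) :
    KimKimSun2020_thm11_via_kobayashi74_three :=
  kimKimSun2020_thm11_via_kobayashi74_three_of_katoFrame hKKS3 h12 h5 h3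

/-! ## §2 The pair consumer at `p = 3` on the finer inputs -/

/-- **A unit Kurihara number at one cyclic level gives Kobayashi's main [C] for both signs at `p = 3`, on the FINER
inputs**: the lead's `kobayashiMainConjecture_three_of_kuriharaUnitAt` fed with §1 — good `3`, `a₃ = 0`, `ρ̄_{W,3}`
onto, the `3`-adic tower onto (`htower`; a theorem on the supersingular classes), (Tam) at `3`, a newform `f` of `W`
(any level) with `X4.KuriharaUnitAt W 3 f`; GRANTED `hKKS3` (claim-grade statement on Kato's objects), `h12`, `h5`,
`h3`. CONDITIONAL; closes nothing. [claim: Kim2025RefinedTNC, status: under-review]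
[cite: KimKimSun2020, Thm. 1.1 and §8.2.2] [cite: Kobayashi2003, Thm. 7.4 (p. 13)] [cite: GreenbergVatsal2000, §3, Remark 3.4] -/
theorem kobayashiMainConjecture_three_of_kuriharaUnitAt_of_facts
    (hKKS3 : KimKimSun2020.thm11_katoMainIdentity_of_kuriharaNumber_ne_zero_three_OPEN)
    (h12 : Kobayashi2003.thm12_signedSelmerDual_finite_torsion)
    (h5 : realPeriodRat_eq_unit_mul_plusPeriod) (h3 : realPeriodRat_eq_unit_mul_plusPeriod_three)
    (W : WeierstrassCurve ℚ) [W.IsElliptic] [W.IsGloballyMinimal] (p : ℕ) [Fact p.Prime]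
    (hp3 : p = 3) (hgood : W.HasGoodReductionAtPrime p) (hap : W.frobeniusTrace p = 0) (hs : Surj W p)
    (htower : ∀ n : ℕ, W.HasSurjectiveModNGaloisRep (p ^ n : ℕ)) (htam : KimKimSun2020TamAt W p)
    {N : ℕ} [NeZero N] (f : CuspForm (Gamma0 N) 2) (hf : IsNewformOf W f) (hunit : KuriharaUnitAt W p f)
    (ε : ℤˣ) : KobayashiMainConjecture W p ε :=
  kobayashiMainConjecture_three_of_kuriharaUnitAt W p
    (kimKimSun2020_thm11_via_kobayashi74_three_of_facts hKKS3 h12 h5 h3) h3 hp3 hgood hap hs htower htam f hf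
    hunit ε

end Summit.BirchSwinnertonDyer.BirchSwinnertonDyer.Theorems.KuriharaRigidity

end
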